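import Literature.Topology.Euclidean.LatticeCubeSkeleton
import Mathlib.Topology.MetricSpace.HausdorffDistance
import Mathlib.Topology.MetricSpace.Thickening
import HarnessLib

/-!
# Dyadic shells around a compact subset of `ℝᴺ`

Topic `Literature/Topology/Euclidean`, continuing `LatticeCubeComplex.lean` /
`LatticeCubeFaces.lean` / `LatticeCubeSkeleton.lean`. The Whitney-type decomposition used in
Hatcher's proof of Thm. A.7 (*Algebraic Topology* (2002), p. 527: cover the complement of `K`
by dyadic cubes whose size is comparable to their distance from `K`), organised here in
**shells** of fixed mesh so that each shell is a finite lattice cube complex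
(`LatticeCube.complex`) and consecutive shells are complexes of the SAME mesh along their
interface (data flows from a coarse shell to the next, finer one by restriction):

* `DyadicShell.mesh h₀ j = h₀ / 2 ^ j`; `DyadicShell.parent`, `child` (level `j + 1` cubes
  inside level `j` cubes: `carrier_subset_carrier_parent`, `exists_child`);
* `DyadicShell.A K h₀ j`: the level-`j` cubes whose corner is within `8 · mesh j` of `K`
  (finite for bounded `K`), `Kj K h₀ j` their union: `K ⊆ Kj`, `Kj (j+1) ⊆ Kj j`,
  `{infDist < 7 mesh j} ⊆ Kj j ⊆ {infDist ≤ 9 mesh j}`;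
* `DyadicShell.S K h₀ j`: the shell cubes (level `j + 1`: children of `A j` not in `A (j+1)`),
  `Shell K h₀ j` their union: `Kj j = Kj (j+1) ∪ Shell j`, `7 mesh (j+1) ≤ infDist ≤ 18 mesh (j+1)`
  on `Shell j`, shells two apart are disjoint, `Shell (j-1)` is the complex of the children of
  `S (j-1)` at mesh `j + 1` (`complex_children`), and no closed face of `Shell j` meets both
  `Shell (j-1)` and `Kj (j+1)` (`disjoint_shell_pred_of_meets_next`).

No `sorry`; [folklore].

## References

* A. Hatcher, *Algebraic Topology*, CUP (2002), Appendix, proof of Thm. A.7 (p. 527).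
  [HatcherAT2002]
-/

noncomputable section

open Set Metric Topology Function

namespace Literature.Topology.Euclidean

namespace DyadicShell

open LatticeCube

variable {N : ℕ}

/-! ### Meshes, parents and children -/

/-- The mesh of level `j`: `h₀ / 2 ^ j`. [folklore] -/
def mesh (h₀ : ℝ) (j : ℕ) : ℝ := h₀ / 2 ^ j

/-- Meshes are positive. [folklore] -/
theorem mesh_pos {h₀ : ℝ} (hh₀ : 0 < h₀) (j : ℕ) : 0 < mesh h₀ j := by
  unfold mesh; positivity

/-- The next mesh is half the mesh. [folklore] -/
theorem mesh_succ (h₀ : ℝ) (j : ℕ) : mesh h₀ (j + 1) = mesh h₀ j / 2 := by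
  unfold mesh; rw [pow_succ]; ring

/-- Meshes decrease. [folklore] -/
theorem mesh_le_mesh {h₀ : ℝ} (hh₀ : 0 ≤ h₀) {i j : ℕ} (hij : i ≤ j) : mesh h₀ j ≤ mesh h₀ i := by
  unfold mesh
  exact div_le_div_of_nonneg_left hh₀ (by positivity) (pow_le_pow_right₀ (by norm_num) hij)

/-- Two levels down the mesh is a quarter. [folklore] -/
theorem mesh_add_two_le {h₀ : ℝ} (hh₀ : 0 ≤ h₀) {i j : ℕ} (hij : i + 2 ≤ j) :
    4 * mesh h₀ j ≤ mesh h₀ i := by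
  have h1 : mesh h₀ j ≤ mesh h₀ (i + 2) := mesh_le_mesh hh₀ hij
  have h2 : mesh h₀ (i + 2) = mesh h₀ i / 4 := by
    rw [mesh_succ, mesh_succ]; ring
  linarith

/-- The parent (level `j`) of a level-`j + 1` lattice index. [folklore] -/
def parent (b : Fin N → ℤ) : Fin N → ℤ := fun i => ⌊(b i : ℝ) / 2⌋

/-- `2 · parent ≤ b`. [folklore] -/
theorem two_parent_le (b : Fin N → ℤ) (i : Fin N) : 2 * parent b i ≤ b i := by
  have h1 : ((parent b i : ℤ) : ℝ) ≤ (b i : ℝ) / 2 := Int.floor_le _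
  have : (2 * parent b i : ℝ) ≤ b i := by linarith
  exact_mod_cast this

/-- `b ≤ 2 · parent + 1`. [folklore] -/
theorem le_two_parent_add_one (b : Fin N → ℤ) (i : Fin N) : b i ≤ 2 * parent b i + 1 := by
  have h1 : (b i : ℝ) / 2 < (parent b i : ℝ) + 1 := Int.lt_floor_add_one _
  have : (b i : ℝ) < 2 * parent b i + 2 := by linarith
  have : b i < 2 * parent b i + 2 := by exact_mod_cast this
  omega

/-- A level-`j + 1` cube lies in its parent cube. [folklore] -/
theorem carrier_subset_carrier_parent {h : ℝ} (hh : 0 ≤ h) (b : Fin N → ℤ) :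
    (Face.top N b).carrier (h / 2) ⊆ (Face.top N (parent b)).carrier h := by
  intro x hx
  rw [Face.mem_carrier_top] at hx ⊢
  intro i
  obtain ⟨h1, h2⟩ := hx i
  have h3 : ((2 * parent b i : ℤ) : ℝ) ≤ b i := by exact_mod_cast two_parent_le b i
  have h4 : (b i : ℝ) ≤ ((2 * parent b i + 1 : ℤ) : ℝ) := by exact_mod_cast le_two_parent_add_one b i
  push_cast at h3 h4
  constructor <;> nlinarith

/-- Corners of a cube and of its parent are `≤ h / 2` apart. [folklore] -/
theorem dist_cornerPoint_parent_le {h : ℝ} (hh : 0 ≤ h) (b : Fin N → ℤ) :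
    dist ((Face.top N b).cornerPoint (h / 2)) ((Face.top N (parent b)).cornerPoint h) ≤ h / 2 := by
  refine (dist_pi_le_iff (by linarith)).2 fun i => ?_
  simp only [Face.cornerPoint, Face.top]
  rw [Real.dist_eq, abs_le]
  have h3 : ((2 * parent b i : ℤ) : ℝ) ≤ b i := by exact_mod_cast two_parent_le b i
  have h4 : (b i : ℝ) ≤ ((2 * parent b i + 1 : ℤ) : ℝ) := by exact_mod_cast le_two_parent_add_one b i
  push_cast at h3 h4
  constructor <;> nlinarith

/-- The child cube of `b` containing a point `x` of the cube `b`. [folklore] -/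
def child (h : ℝ) (b : Fin N → ℤ) (x : Fin N → ℝ) : Fin N → ℤ := fun i =>
  max (2 * b i) (min (2 * b i + 1) ⌊x i / (h / 2)⌋)

/-- The parent of a child of `b` is `b`. [folklore] -/
theorem parent_child (h : ℝ) (b : Fin N → ℤ) (x : Fin N → ℝ) : parent (child h b x) = b := by
  funext i
  simp only [parent, child]
  have h1 : 2 * b i ≤ max (2 * b i) (min (2 * b i + 1) ⌊x i / (h / 2)⌋) := le_max_left _ _
  have h2 : max (2 * b i) (min (2 * b i + 1) ⌊x i / (h / 2)⌋) ≤ 2 * b i + 1 :=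
    max_le (by omega) (min_le_left _ _)
  rw [Int.floor_eq_iff]
  set m := max (2 * b i) (min (2 * b i + 1) ⌊x i / (h / 2)⌋)
  have h1' : (2 * b i : ℝ) ≤ m := by exact_mod_cast h1
  have h2' : (m : ℝ) ≤ 2 * b i + 1 := by exact_mod_cast h2
  constructor <;> linarith

/-- Every point of a cube lies in one of its children. [folklore] -/
theorem mem_carrier_child {h : ℝ} (hh : 0 < h) {b : Fin N → ℤ} {x : Fin N → ℝ}
    (hx : x ∈ (Face.top N b).carrier h) : x ∈ (Face.top N (child h b x)).carrier (h / 2) := by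
  rw [Face.mem_carrier_top] at hx ⊢
  intro i
  obtain ⟨h1, h2⟩ := hx i
  have hh2 : 0 < h / 2 := by linarith
  have hf1 : ((⌊x i / (h / 2)⌋ : ℤ) : ℝ) ≤ x i / (h / 2) := Int.floor_le _
  have hf2 : x i / (h / 2) < (⌊x i / (h / 2)⌋ : ℝ) + 1 := Int.lt_floor_add_one _
  rw [le_div_iff₀ hh2] at hf1
  rw [div_lt_iff₀ hh2] at hf2
  simp only [child]
  -- case analysis on the clamp
  rcases le_total ⌊x i / (h / 2)⌋ (2 * b i) with hlo | hlo
  · have : max (2 * b i) (min (2 * b i + 1) ⌊x i / (h / 2)⌋) = 2 * b i :=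
      max_eq_left ((min_le_right _ _).trans hlo)
    rw [this]; push_cast
    have hlo' : ((⌊x i / (h / 2)⌋ : ℤ) : ℝ) ≤ 2 * b i := by exact_mod_cast hlo
    constructor <;> nlinarith
  · rcases le_total (2 * b i + 1) ⌊x i / (h / 2)⌋ with hhi | hhi
    · have : max (2 * b i) (min (2 * b i + 1) ⌊x i / (h / 2)⌋) = 2 * b i + 1 := by
        rw [min_eq_left hhi, max_eq_right (by omega)]
      rw [this]; push_cast
      have hhi' : (2 * b i + 1 : ℝ) ≤ ((⌊x i / (h / 2)⌋ : ℤ) : ℝ) := by exact_mod_cast hhi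
      constructor <;> nlinarith
    · have : max (2 * b i) (min (2 * b i + 1) ⌊x i / (h / 2)⌋) = ⌊x i / (h / 2)⌋ := by
        rw [min_eq_right hhi, max_eq_right hlo]
      rw [this]
      constructor <;> nlinarith

/-- The complex of the children of `𝒬` at half the mesh is the complex of `𝒬`. [folklore] -/
theorem complex_children {h : ℝ} (hh : 0 < h) (𝒬 𝒞 : Finset (Fin N → ℤ))
    (h𝒞 : ∀ b', b' ∈ 𝒞 ↔ parent b' ∈ 𝒬) : complex 𝒞 (h / 2) = complex 𝒬 h := by
  ext x
  rw [mem_complex, mem_complex]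
  constructor
  · rintro ⟨b', hb', hx⟩
    exact ⟨parent b', (h𝒞 b').1 hb', carrier_subset_carrier_parent hh.le b' hx⟩
  · rintro ⟨b, hb, hx⟩
    exact ⟨child h b x, (h𝒞 _).2 (by rw [parent_child]; exact hb), mem_carrier_child hh hx⟩

/-! ### Distance to `K` on a cube -/

/-- Points of a cube are not much farther from `K` than its corner. [folklore] -/
theorem infDist_le_infDist_cornerPoint_add {h : ℝ} (hh : 0 ≤ h) (K : Set (Fin N → ℝ))
    {b : Fin N → ℤ} {x : Fin N → ℝ} (hx : x ∈ (Face.top N b).carrier h) :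
    infDist x K ≤ infDist ((Face.top N b).cornerPoint h) K + h := by
  have h1 := infDist_le_infDist_add_dist (s := K) (x := x) (y := (Face.top N b).cornerPoint h)
  have h2 : dist x ((Face.top N b).cornerPoint h) ≤ h := by
    rw [dist_comm]; exact Face.dist_cornerPoint_le hh hx
  linarith

/-- The corner of a cube is not much farther from `K` than its points. [folklore] -/
theorem infDist_cornerPoint_le_infDist_add {h : ℝ} (hh : 0 ≤ h) (K : Set (Fin N → ℝ))
    {b : Fin N → ℤ} {x : Fin N → ℝ} (hx : x ∈ (Face.top N b).carrier h) :
    infDist ((Face.top N b).cornerPoint h) K ≤ infDist x K + h := by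
  have h1 := infDist_le_infDist_add_dist (s := K) (x := (Face.top N b).cornerPoint h) (y := x)
  have h2 : dist ((Face.top N b).cornerPoint h) x ≤ h := Face.dist_cornerPoint_le hh hx
  linarith

/-! ### The cubes near `K` at level `j` -/

variable (K : Set (Fin N → ℝ)) (h₀ : ℝ)

/-- The level-`j` lattice indices whose corner is within `8 · mesh j` of `K`. [folklore] -/
def nearSet (j : ℕ) : Set (Fin N → ℤ) :=
  {b | infDist ((Face.top N b).cornerPoint (mesh h₀ j)) K ≤ 8 * mesh h₀ j}

variable {K h₀}

/-- For bounded nonempty `K` the near set is finite. [folklore] -/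
theorem nearSet_finite (hK : Bornology.IsBounded K) (hKne : K.Nonempty) (hh₀ : 0 < h₀) (j : ℕ) :
    (nearSet K h₀ j).Finite := by
  have hm := mesh_pos hh₀ j
  refine (finite_setOf_carrier_top_inter_nonempty hm
    (S := cthickening (8 * mesh h₀ j) K) hK.cthickening).subset fun b hb => ?_
  refine ⟨(Face.top N b).cornerPoint (mesh h₀ j), Face.cornerPoint_mem_carrier hm.le, ?_⟩
  rw [mem_cthickening_iff]
  have h1 : infDist ((Face.top N b).cornerPoint (mesh h₀ j)) K ≤ 8 * mesh h₀ j := hb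
  have hne : infEDist ((Face.top N b).cornerPoint (mesh h₀ j)) K ≠ ⊤ := Metric.infEDist_ne_top hKne
  calc infEDist ((Face.top N b).cornerPoint (mesh h₀ j)) K
      = ENNReal.ofReal (infDist ((Face.top N b).cornerPoint (mesh h₀ j)) K) := by
        rw [infDist, ENNReal.ofReal_toReal hne]
    _ ≤ ENNReal.ofReal (8 * mesh h₀ j) := ENNReal.ofReal_le_ofReal h1

variable (K h₀) in
/-- **The level-`j` cubes near `K`** (as a finite set; empty if `K` is unbounded or empty). [folklore] -/
def A (j : ℕ) : Finset (Fin N → ℤ) := by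
  classical
  exact if hK : Bornology.IsBounded K ∧ K.Nonempty ∧ 0 < h₀ then
    (nearSet_finite hK.1 hK.2.1 hK.2.2 j).toFinset else ∅

/-- Membership in `A`. [folklore] -/
theorem mem_A (hK : Bornology.IsBounded K) (hKne : K.Nonempty) (hh₀ : 0 < h₀) {j : ℕ}
    {b : Fin N → ℤ} : b ∈ A K h₀ j ↔ infDist ((Face.top N b).cornerPoint (mesh h₀ j)) K ≤ 8 * mesh h₀ j := by
  classical
  have hc : Bornology.IsBounded K ∧ K.Nonempty ∧ 0 < h₀ := ⟨hK, hKne, hh₀⟩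
  simp only [A, dif_pos hc, Set.Finite.mem_toFinset]
  rfl

variable (K h₀) in
/-- **The level-`j` neighbourhood complex** `K_j`. [folklore] -/
def Kj (j : ℕ) : Set (Fin N → ℝ) := complex (A K h₀ j) (mesh h₀ j)

variable (K h₀) in
/-- **The shell cubes**: children of `A j` not in `A (j + 1)` (level `j + 1`). [folklore] -/
def S (j : ℕ) : Finset (Fin N → ℤ) := by
  classical
  exact ((A K h₀ j).biUnion fun b => (A K h₀ (j + 1) ∪
    (Finset.univ.image fun e : Fin N → Bool => fun i => 2 * b i + if e i then 1 else 0)).filter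
      fun b' => parent b' = b).filter fun b' => b' ∉ A K h₀ (j + 1)

/-- Membership in the shell cubes. [folklore] -/
theorem mem_S {j : ℕ} {b' : Fin N → ℤ} :
    b' ∈ S K h₀ j ↔ parent b' ∈ A K h₀ j ∧ b' ∉ A K h₀ (j + 1) := by
  classical
  simp only [S, Finset.mem_filter, Finset.mem_biUnion, Finset.mem_union, Finset.mem_image,
    Finset.mem_univ, true_and]
  constructor
  · rintro ⟨⟨b, hb, -, hpb⟩, hn⟩
    exact ⟨hpb ▸ hb, hn⟩
  · rintro ⟨hp, hn⟩
    refine ⟨⟨parent b', hp, Or.inr ⟨fun i => decide (b' i = 2 * parent b' i + 1), ?_⟩, rfl⟩, hn⟩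
    funext i
    have h1 := two_parent_le b' i
    have h2 := le_two_parent_add_one b' i
    by_cases hi : b' i = 2 * parent b' i + 1
    · simp [hi]
    · simp [hi]; omega

variable (K h₀) in
/-- **The `j`-th shell** (a level-`j + 1` cube complex). [folklore] -/
def Shell (j : ℕ) : Set (Fin N → ℝ) := complex (S K h₀ j) (mesh h₀ (j + 1))

variable (K h₀) in
/-- The children of the shell cubes `S j` (level `j + 2`), presenting `Shell j` at the next
mesh. [folklore] -/
def S' (j : ℕ) : Finset (Fin N → ℤ) := by
  classical
  exact ((S K h₀ j).biUnion fun b =>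
    Finset.univ.image fun e : Fin N → Bool => fun i => 2 * b i + if e i then 1 else 0)

/-- Membership in `S'`. [folklore] -/
theorem mem_S' {j : ℕ} {b'' : Fin N → ℤ} : b'' ∈ S' K h₀ j ↔ parent b'' ∈ S K h₀ j := by
  classical
  simp only [S', Finset.mem_biUnion, Finset.mem_image, Finset.mem_univ, true_and]
  constructor
  · rintro ⟨b, hb, e, rfl⟩
    have : parent (fun i => 2 * b i + if e i then 1 else 0) = b := by
      funext i
      simp only [parent]
      rw [Int.floor_eq_iff]
      by_cases he : e i
      · simp [he]; constructor <;> linarith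
      · simp [he]
    rwa [this]
  · intro hp
    refine ⟨parent b'', hp, fun i => decide (b'' i = 2 * parent b'' i + 1), ?_⟩
    funext i
    have h1 := two_parent_le b'' i
    have h2 := le_two_parent_add_one b'' i
    by_cases hi : b'' i = 2 * parent b'' i + 1
    · simp [hi]
    · simp [hi]; omega

/-- `Shell j` presented at mesh `j + 2`. [folklore] -/
theorem complex_S' (hh₀ : 0 < h₀) (j : ℕ) :
    complex (S' K h₀ j) (mesh h₀ (j + 2)) = Shell K h₀ j := by
  rw [Shell, show mesh h₀ (j + 2) = mesh h₀ (j + 1) / 2 from mesh_succ h₀ (j + 1)]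
  exact complex_children (mesh_pos hh₀ _) _ _ fun b'' => mem_S'

section Facts

variable (hK : Bornology.IsBounded K) (hKne : K.Nonempty) (hh₀ : 0 < h₀)
include hK hKne hh₀

/-- Points within `7 · mesh j` of `K` lie in `K_j`. [folklore] -/
theorem mem_Kj_of_infDist_lt {j : ℕ} {x : Fin N → ℝ} (hx : infDist x K < 7 * mesh h₀ j) :
    x ∈ Kj K h₀ j := by
  have hm := mesh_pos hh₀ j
  refine mem_complex.2 ⟨_, (mem_A hK hKne hh₀).2 ?_, mem_carrier_top_floor hm x⟩
  have := infDist_cornerPoint_le_infDist_add hm.le K (mem_carrier_top_floor hm x)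
  linarith

/-- `K ⊆ K_j`. [folklore] -/
theorem subset_Kj (j : ℕ) : K ⊆ Kj K h₀ j := fun x hx =>
  mem_Kj_of_infDist_lt hK hKne hh₀ (by rw [infDist_zero_of_mem hx]; linarith [mesh_pos hh₀ j])

/-- Points of `K_j` are within `9 · mesh j` of `K`. [folklore] -/
theorem infDist_le_of_mem_Kj {j : ℕ} {x : Fin N → ℝ} (hx : x ∈ Kj K h₀ j) :
    infDist x K ≤ 9 * mesh h₀ j := by
  have hm := mesh_pos hh₀ j
  obtain ⟨b, hb, hxb⟩ := mem_complex.1 hx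
  have h1 := (mem_A hK hKne hh₀).1 hb
  have h2 := infDist_le_infDist_cornerPoint_add hm.le K hxb
  linarith

/-- `K_{j+1} ⊆ K_j`. [folklore] -/
theorem Kj_succ_subset (j : ℕ) : Kj K h₀ (j + 1) ⊆ Kj K h₀ j := by
  intro x hx
  have hm := mesh_pos hh₀ j
  obtain ⟨b', hb', hxb'⟩ := mem_complex.1 hx
  have h1 := (mem_A hK hKne hh₀).1 hb'
  rw [mesh_succ] at h1 hxb'
  refine mem_complex.2 ⟨parent b', (mem_A hK hKne hh₀).2 ?_, carrier_subset_carrier_parent hm.le b' hxb'⟩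
  have h2 := dist_cornerPoint_parent_le hm.le b' (N := N)
  have h3 := infDist_le_infDist_add_dist (s := K) (x := (Face.top N (parent b')).cornerPoint (mesh h₀ j))
    (y := (Face.top N b').cornerPoint (mesh h₀ j / 2))
  rw [dist_comm] at h3
  linarith

omit hK hKne in
/-- `Shell j ⊆ K_j`. [folklore] -/
theorem shell_subset_Kj (j : ℕ) : Shell K h₀ j ⊆ Kj K h₀ j := by
  intro x hx
  have hm := mesh_pos hh₀ j
  obtain ⟨b', hb', hxb'⟩ := mem_complex.1 hx
  rw [mesh_succ] at hxb'
  exact mem_complex.2 ⟨parent b', (mem_S.1 hb').1, carrier_subset_carrier_parent hm.le b' hxb'⟩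

/-- **`K_j = K_{j+1} ∪ Shell j`.** [folklore] -/
theorem Kj_eq_union (j : ℕ) : Kj K h₀ j = Kj K h₀ (j + 1) ∪ Shell K h₀ j := by
  refine Subset.antisymm (fun x hx => ?_)
    (union_subset (Kj_succ_subset hK hKne hh₀ j) (shell_subset_Kj hh₀ j))
  have hm := mesh_pos hh₀ j
  obtain ⟨b, hb, hxb⟩ := mem_complex.1 hx
  have hxc := mem_carrier_child hm hxb
  rw [← mesh_succ] at hxc
  by_cases hc : child (mesh h₀ j) b x ∈ A K h₀ (j + 1)
  · exact Or.inl (mem_complex.2 ⟨_, hc, hxc⟩)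
  · refine Or.inr (mem_complex.2 ⟨_, mem_S.2 ⟨?_, hc⟩, hxc⟩)
    rw [parent_child]; exact hb

/-- On the shell, `7 · mesh (j+1) ≤ infDist ≤ 18 · mesh (j+1)`. [folklore] -/
theorem infDist_bounds_of_mem_shell {j : ℕ} {x : Fin N → ℝ} (hx : x ∈ Shell K h₀ j) :
    7 * mesh h₀ (j + 1) ≤ infDist x K ∧ infDist x K ≤ 18 * mesh h₀ (j + 1) := by
  have hm := mesh_pos hh₀ (j + 1)
  constructor
  · obtain ⟨b', hb', hxb'⟩ := mem_complex.1 hx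
    have h1 : ¬ infDist ((Face.top N b').cornerPoint (mesh h₀ (j + 1))) K ≤ 8 * mesh h₀ (j + 1) :=
      fun hle => (mem_S.1 hb').2 ((mem_A hK hKne hh₀).2 hle)
    have h2 := infDist_cornerPoint_le_infDist_add hm.le K hxb'
    linarith
  · have := infDist_le_of_mem_Kj hK hKne hh₀ (shell_subset_Kj hh₀ j hx)
    rw [mesh_succ]; linarith

/-- **Shells two or more levels apart are disjoint.** [folklore] -/
theorem disjoint_shell {i j : ℕ} (hij : i + 2 ≤ j) : Disjoint (Shell K h₀ i) (Shell K h₀ j) := by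
  rw [Set.disjoint_left]
  intro x hxi hxj
  have h1 := (infDist_bounds_of_mem_shell hK hKne hh₀ hxi).1
  have h2 := (infDist_bounds_of_mem_shell hK hKne hh₀ hxj).2
  have h3 : 4 * mesh h₀ (j + 1) ≤ mesh h₀ (i + 1) := mesh_add_two_le hh₀.le (by omega)
  have hm := mesh_pos hh₀ (i + 1)
  linarith

/-- **No closed face of the shell `j ≥ 1` meets both the previous shell and `K_{j+1}`.**
[folklore] -/
theorem disjoint_shell_pred_of_meets_next {j : ℕ} (hj : 1 ≤ j) {F : Face N}
    (hne : (F.carrier (mesh h₀ (j + 1)) ∩ Kj K h₀ (j + 1)).Nonempty) :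
    Disjoint (F.carrier (mesh h₀ (j + 1))) (Shell K h₀ (j - 1)) := by
  rw [Set.disjoint_left]
  intro y hyF hyS
  obtain ⟨x, hxF, hxK⟩ := hne
  have hm := mesh_pos hh₀ (j + 1)
  have h1 := infDist_le_of_mem_Kj hK hKne hh₀ hxK
  have h2 := (infDist_bounds_of_mem_shell hK hKne hh₀ hyS).1
  have hj' : j - 1 + 1 = j := by omega
  rw [hj'] at h2
  have h3 : mesh h₀ j = 2 * mesh h₀ (j + 1) := by rw [mesh_succ]; ring
  have h4 : dist y x ≤ mesh h₀ (j + 1) := Face.dist_le_of_mem_carrier (G := F) hm.le hyF hxF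
  have h5 := infDist_le_infDist_add_dist (s := K) (x := y) (y := x)
  linarith

/-- Points of `K_{j₀}` off `K` lie in some shell `j ≥ j₀`. [folklore] -/
theorem exists_mem_shell_of_mem_Kj (hKc : IsClosed K) {j₀ : ℕ} {x : Fin N → ℝ}
    (hx : x ∈ Kj K h₀ j₀) (hxK : x ∉ K) : ∃ j, j₀ ≤ j ∧ x ∈ Shell K h₀ j := by
  classical
  have hd : 0 < infDist x K := (hKc.notMem_iff_infDist_pos hKne).1 hxK
  -- `x ∉ K_j` for `j` large
  obtain ⟨n, hn⟩ : ∃ n : ℕ, 9 * mesh h₀ n < infDist x K := by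
    obtain ⟨n, hn⟩ := exists_pow_lt_of_lt_one (show 0 < infDist x K / (9 * h₀) by positivity)
      (show ((2 : ℝ)⁻¹) < 1 by norm_num)
    refine ⟨n, ?_⟩
    unfold mesh
    rw [inv_pow] at hn
    rw [lt_div_iff₀ (by positivity)] at hn
    calc 9 * (h₀ / 2 ^ n) = (2 ^ n)⁻¹ * (9 * h₀) := by ring
      _ < infDist x K := hn
  have hxn : ∀ j, n ≤ j → x ∉ Kj K h₀ j := fun j hj hxj => by
    have h1 := infDist_le_of_mem_Kj hK hKne hh₀ hxj
    have h2 := mesh_le_mesh hh₀.le hj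
    linarith
  -- the last `j ≥ j₀` with `x ∈ K_j`
  have hj₀n : j₀ < n := by
    by_contra hle
    exact hxn j₀ (not_lt.1 hle) hx
  let P : ℕ → Prop := fun j => x ∈ Kj K h₀ j
  let j₁ := Nat.findGreatest P n
  have hP : P j₁ := Nat.findGreatest_spec (P := P) hj₀n.le hx
  have hj₁ : j₀ ≤ j₁ := Nat.le_findGreatest hj₀n.le hx
  have hnot : x ∉ Kj K h₀ (j₁ + 1) := by
    intro hx'
    have hle : j₁ + 1 ≤ n := by
      by_contra hlt
      exact hxn (j₁ + 1) (by omega) hx'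
    have := Nat.le_findGreatest (P := P) hle hx'
    omega
  refine ⟨j₁, hj₁, ?_⟩
  have := (Kj_eq_union hK hKne hh₀ j₁).subset hP
  exact this.resolve_left hnot

/-- **Local finiteness of the shells off `K`**: near a point off `K` only finitely many shells
appear. [folklore] -/
theorem finite_shells_near (hKc : IsClosed K) {x : Fin N → ℝ} (hxK : x ∉ K) :
    ∃ t > 0, {j | (Shell K h₀ j ∩ ball x t).Nonempty}.Finite := by
  have hd : 0 < infDist x K := (hKc.notMem_iff_infDist_pos hKne).1 hxK
  refine ⟨infDist x K / 2, by positivity, ?_⟩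
  obtain ⟨n, hn⟩ : ∃ n : ℕ, 18 * mesh h₀ n < infDist x K / 2 := by
    obtain ⟨n, hn⟩ := exists_pow_lt_of_lt_one (show 0 < infDist x K / (36 * h₀) by positivity)
      (show ((2 : ℝ)⁻¹) < 1 by norm_num)
    refine ⟨n, ?_⟩
    unfold mesh
    rw [inv_pow, lt_div_iff₀ (by positivity)] at hn
    calc 18 * (h₀ / 2 ^ n) = (2 ^ n)⁻¹ * (36 * h₀) / 2 := by ring
      _ < infDist x K / 2 := by linarith
  refine (Set.finite_lt_nat n).subset fun j hj => ?_
  obtain ⟨y, hyS, hyx⟩ := hj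
  show j < n
  by_contra hle
  have h1 := (infDist_bounds_of_mem_shell hK hKne hh₀ hyS).2
  have h2 : mesh h₀ (j + 1) ≤ mesh h₀ n := mesh_le_mesh hh₀.le (by omega)
  have h3 := infDist_le_infDist_add_dist (s := K) (x := x) (y := y)
  rw [dist_comm] at h3
  have h4 : dist y x < infDist x K / 2 := mem_ball.1 hyx
  linarith

end Facts

/-- Shells are compact. [folklore] -/
theorem isCompact_shell (K : Set (Fin N → ℝ)) (h₀ : ℝ) (j : ℕ) : IsCompact (Shell K h₀ j) :=
  isCompact_complex

/-- Shells are closed. [folklore] -/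
theorem isClosed_shell (K : Set (Fin N → ℝ)) (h₀ : ℝ) (j : ℕ) : IsClosed (Shell K h₀ j) :=
  (isCompact_shell K h₀ j).isClosed

end DyadicShell

end Literature.Topology.Euclidean

end
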